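import Summits.AtomisticToContinuum.Crystallization.Theorems.ChartedZeroExcessLayeredLatticeLiouvilleTPb

/-!
# Zero-excess layered lattice Liouville — part TQ (lens-2 g40 node «LaunderingByScales»): layer 3 beneath (Λ♭ˣ) `ThinLaunderingPX`

## The node (structural dichotomy: the ONE special scale vs the generic scales)
(Λ♭ˣ) «thin laundering» (part TN) asks, UNIFORMLY in the level `η ≤ η₁` at a FIXED window scale `R ≥ R₁` of the thin regime `η·R² < c₀`, for a
true-word equilibrium chart (free frame, tolerance `s'`) registering `win R` at level `Cl·η`.  The halving basin drives `η → 0` at fixed scales, so the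
regime of use is ULTRA-thin, where the only mechanism on record (memo g37 F7(iii)) is a REGRESS over scales: the polar garbage of the scale-`R` datum is
controlled by the interior of the scale-`2R` datum, whose own garbage is controlled one scale up, …, until the thin regime ends.  This part types that
regress as TWO pieces in ONE currency and proves the induction once and for all:
* the currency `IsLaunderedAt a s' Λ S η R C` := the conclusion of (Λ♭ˣ) at scale `R` and RELATIVE level `C` (registration level `C·η`);
* ★ (Λ₀) `LaunderingAprioriPX` — the SPECIAL scale: a thin datum at scale `D` is laundered at the DEGRADING level `A₀ + K/(η·D²)` (affordable exactly
  at the top of the thin regime, `η·D² ≍ c`: saturation bound on the garbage amplitude, cost `∝ D`, budget `∝ η·D³`);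
* ★★ (Λ↑) `LaunderingStepPX` — the GENERIC scales: ONE dyadic step «laundered at `2R` at level `C` ⇒ laundered at `R` at level `A + β·C`» with a
  contraction `β < 1` (transport attenuation of the `2R`-datum's garbage into `win R`, amplitude bounded at `cap_{2R}` through the laundered `2R`-chart);
* ★★★ the seam `thinLaunderingPX_of_apriori_step` : (B1)(s) ∧ (Λ₀) ∧ (Λ↑) ⇒ (Λ♭ˣ) (PROVED): `c₀ := min(c_a,c_s)/4`; the regress depth `n` is the least
  with `4ⁿ·η·R² ≥ c⋆/4` (then `< c⋆`, so every dyadic scale `2ᵏR`, `k ≤ n`, is thin for both pieces); at the top scale the multi-scale hypothesis gives the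
  datum, (B1) + D1 the true-word bond-isomorphic chart, (Λ₀) the level `A₀ + 4K/c⋆ ≤ Cmax := A/(1−β) + A₀ + 4K/c⋆`; `Cmax` is invariant under the step
  (`A + β·Cmax ≤ Cmax`), so `n` applications of (Λ↑) land at scale `R` with `Cl := Cmax + 1` — no logarithms, no `η`-dependence.
Both pieces are implied by the target: (Λ♭ˣ) ⇒ (Λ₀) (`K := 0`) and (Λ♭ˣ) ∧ (B1) ⇒ (Λ↑) (`β := 0`) (PROVED projections), so the cut introduces no new
falsity; both are load-bearing (a junk start at level `≍ 1/η` cannot replace (Λ₀) near the thick end, where only `O(1)` steps are thin; (Λ↑) alone has no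
start).  Columns `_16XH18_tol` / `_16XH18` (ν := 1/2000): `_16XH17` with the leaf (Λ♭ˣ) replaced by (Λ₀) ∧ (Λ↑) — 23 opaque leaves.
## Erratum to the g39 memo §7 / standing order 664 (iii) (paper level; memo `ERRATUM-g40-ShearFamilyAndTails.md`)
The cut ordered there — Λ1 «ReframedDataPX» / Λ2 «OffsetLaunderingP» (EXACT layer equality on a height range) / Λ3 «letter agreement», with a shared
support lemma «NashLayeredRigidityP: same frame + same word + one common gap ⇒ equal up to a normal translation» — is NOT typed, because two of its
pieces are false as sketched: (E1) SHEAR FAMILY — `w m ↦ w m + m•ε` (ε in-plane) keeps `LayeredHom L w` an equilibrium chart on the SAME frame (a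
uniformly sheared Bravais crystal is clean and single-site Nash by inversion symmetry), so «Nash ⇒ hollow registries» and «NashLayeredRigidityP» fail;
the correct invariant is the transmitted stress 3-vector, ALREADY in the tree: `OverbindingBudgetStackedRigidityW.gapStress_const_of_indep` (PROVED) and
the bounded-distance slaving `ChartedPlanarOrderProfileSlavingLJ.ProfileSlavingLJ` (typed column E1 ∧ D1 ∧ W) — THAT is the support lemma shared by
(N♮) and the laundering line, cited, not re-typed; (E2) LJ TAILS — `lennardJones` has no cutoff, equilibrium interface data inside a height range depend
on the letters outside it (profile `κ_j ∼ j⁻⁴`), so exact laundering on a height range is false and the regress cannot be split off as an exact piece;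
it is the seam of THIS part instead.  0 sorry; 0 EQUIV; placeholder-free; no type-class declarations, custom syntax or option pragmas.
-/

noncomputable section

open scoped BigOperators InnerProductSpace RealInnerProductSpace
open MeasureTheory Set Metric Filter Topology
open Summit.AtomisticToContinuum.Crystallization.Theorems.ChartedPlanarOrderRigidityDoor
  (E3 IsClean IsNash IsCharted IsEStarGSC VisibleGap PertRegime atomsIn siteEnergy eStar BindingSurface)
open Summit.AtomisticToContinuum.Crystallization.Theorems.ChartedPlanarOrderDensityDichotomy (μS IsSep nK nK_nonneg excess)
open Summit.AtomisticToContinuum.Crystallization.Theorems.ChartedPlanarOrderMesoCut (IsDoorSet NearHom LayeredHom layerOf EnvClose)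
open Summit.AtomisticToContinuum.Crystallization.Theorems.ChartedPlanarOrderDoorLayered
  (TwoPeriodic DoorPeriodic PeriodicBulkGapDoor NearHomL2BD Layered atomsIn_subset)
open Summit.AtomisticToContinuum.Crystallization.Theorems.ChartedPlanarOrderDoorLayeredOsc (IsTwoShellAffineGood DoorPeriodicOsc)
open Summit.AtomisticToContinuum.Crystallization.Theorems.ChartedPlanarOrderCleanScaleP (IsCleanP IsDoorSetP DoorPeriodicP isDoorSetP_one_iff)
open Literature.MathematicalPhysics.StatisticalMechanics (lennardJones IsHaggSeq triangularVec₁ triangularVec₂)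

namespace Summit.AtomisticToContinuum.Crystallization.Theorems.ChartedZeroExcessLayeredLatticeLiouville

/-! ### XVIII.1  The currency: «laundered at scale `R`, relative level `C`» -/

/-- **`IsLaunderedAt a s' Λ S η R C`** — EXACTLY the conclusion of (Λ♭ˣ) `ThinLaunderingPX` at scale `R` with `Cl := C`: a FREE equilibrium chart
`LayeredHom L₁ w₁` (`s'`-conformal about `a`, clean, Nash), a registration `Ψ₁` of `win R` into it at level `C·η` (radius 4, free position scale `ρ`), a
bijective bond isomorphism `Φ : S → LayeredHom L₁ w₁` (so the chart carries `S`'s TRUE word), and layer-compatibility of `Ψ₁` with `Φ` at the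
well-registered sites.  Monotone in `C` (`IsLaunderedAt.mono`). [this file, g40] -/
def IsLaunderedAt (a s' Λ : ℝ) (S : Set E3) (η R C : ℝ) : Prop :=
  ∃ (L₁ : E3 ≃L[ℝ] E3) (w₁ : ℤ → E3) (Ψ₁ : E3 → E3) (ρ : ℝ) (τ₁ : E3 → ℝ) (Φ : E3 → E3),
    IsEquilChart a s' Λ L₁ w₁ ∧ IsRegistered (C * η) 4 ρ S (atomsIn (μS S) 0 R) (LayeredHom (L₁ : E3 →L[ℝ] E3) w₁) Ψ₁ τ₁ ∧
      Set.BijOn Φ S (LayeredHom (L₁ : E3 →L[ℝ] E3) w₁) ∧ IsBondIso S Φ ∧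
        ∀ x ∈ atomsIn (μS S) 0 R, τ₁ x < 1 / 8 →
          ∃ m : ℤ, Ψ₁ x ∈ layerOf (L₁ : E3 →L[ℝ] E3) w₁ m ∧ Φ x ∈ layerOf (L₁ : E3 →L[ℝ] E3) w₁ m

/-- the currency is monotone in the relative level (for `η ≥ 0`). [this file, g40] -/
theorem IsLaunderedAt.mono {a s' Λ : ℝ} {S : Set E3} {η R C C' : ℝ} (hCC' : C ≤ C') (hη : 0 ≤ η)
    (h : IsLaunderedAt a s' Λ S η R C) : IsLaunderedAt a s' Λ S η R C' := by
  obtain ⟨L₁, w₁, Ψ₁, ρ, τ₁, Φ, hE, hreg, hbij, hiso, hlay⟩ := h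
  exact ⟨L₁, w₁, Ψ₁, ρ, τ₁, Φ, hE, hreg.mono (mul_le_mul_of_nonneg_right hCC' hη), hbij, hiso, hlay⟩

/-! ### XVIII.2  The two pieces -/

/-- ★ **(Λ₀) «LaunderingAprioriPX aHi Λ θ s s'»** — THE SPECIAL SCALE (a-priori laundering at a level that degrades towards the ultra-thin end): there is a
regime constant `c > 0` and, for every `δ, a, C₁`, constants `A₀, K ≥ 0` (ceiling `η₁`, floor `R₁`) such that every thin datum at scale `D` (`η·D² < c`;
same inputs as (Λ♭ˣ): the multi-scale hypothesis, the scale-`D` equilibrium `s`-chart registering `win D` at level `η`, and an equilibrium chart on the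
same lattice with a bijective bond isomorphism from `S`) is laundered at scale `D` at relative level `A₀ + K/(η·D²)`.  Mechanism: letter truth in reach
(wrong letters only on window layers of population `≤ 6η·D³/t⋆²`, affordable), tension retune of the true-word chart to the datum's stress, and the
SATURATION bound on the datum's garbage profile (polar cost `≤ c_f·D`, i.e. relative level `≤ (c_f/c_d)/(η·D²)`).  WEAKER than (Λ♭ˣ): (Λ♭ˣ) ⇒ (Λ₀) with
`K := 0` (`launderingAprioriPX_of_thinLaunderingPX`, PROVED).  Why it might fail: the re-framing in the special (all-`c` reach, tilted frame) case must be
done at a single scale; the garbage of far sources decays only like `j⁻²` (still summable against the linear polar population).  TRUE-type; M–L.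
[this file, g40] -/
def LaunderingAprioriPX (aHi Λ θ s s' : ℝ) : Prop :=
  ∃ c : ℝ, 0 < c ∧ ∀ δ : ℝ, 0 < δ → ∀ a : ℝ, 0 < a → ∀ C₁ : ℝ, 0 ≤ C₁ →
    ∃ A₀ : ℝ, 0 ≤ A₀ ∧ ∃ K : ℝ, 0 ≤ K ∧ ∃ η₁ : ℝ, 0 < η₁ ∧ ∃ R₁ : ℝ, 0 < R₁ ∧
      ∀ S : Set E3, IsDoorSetP aHi δ S → (∀ q ∈ S, IsTwoShellAffineGood θ S q) → HasQuadExcess C₁ S →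
        ∀ η : ℝ, 0 < η → η ≤ η₁ → ∀ D : ℝ, R₁ ≤ D → η * D ^ 2 < c →
          (∀ D' : ℝ, D ≤ D' → NearHomH1BDE a s Λ η 4 D' S (atomsIn (μS S) 0 D')) →
            ∀ (L : E3 ≃L[ℝ] E3) (w' : ℤ → E3) (Ψ' : E3 → E3) (τ' : E3 → ℝ), IsEquilChart a s Λ L w' →
              IsRegistered η 4 D S (atomsIn (μS S) 0 D) (LayeredHom (L : E3 →L[ℝ] E3) w') Ψ' τ' →
                ∀ (w : ℤ → E3) (Ψ₀ : E3 → E3), IsEquilChart a s Λ L w → Set.BijOn Ψ₀ S (LayeredHom (L : E3 →L[ℝ] E3) w) →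
                  IsBondIso S Ψ₀ → IsLaunderedAt a s' Λ S η D (A₀ + K / (η * D ^ 2))

/-- ★★ **(Λ↑) «LaunderingStepPX aHi Λ θ s s'»** — THE GENERIC SCALES (one dyadic step of the regress, the contraction made explicit): there is a regime
constant `c > 0` and, for every `δ, a, C₁`, constants `A ≥ 0`, `0 ≤ β < 1` (ceiling `η₁`, floor `R₁`) such that, in the thin regime `η·R² < c` and under
the multi-scale hypothesis at the scales `≥ R`, «laundered at scale `2R` at relative level `C` ⇒ laundered at scale `R` at relative level `A + β·C`» for
every `C ≥ 0`.  Mechanism (memo g37 F7(iii), made E2-honest): the `2R`-DATUM `H″` (level `η`, from the hypothesis) has true letters on every layer meeting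
`win R`; on `win R` it equals a retuned true-word chart plus its garbage profile `u″`, sourced beyond `reach(2R)`, whose non-affine part on `win R` is the
part at `cap_{2R}` attenuated by the transport factor `a(R)²`; and the amplitude at `cap_{2R}` is bounded through the laundered `2R`-chart (both fit `S`
there; decaying profiles are transverse to affine fields): level `≤ 16C_δ(1 + a²c′)·1 + 16C_δ·a²c′·C`.  WEAKER than (Λ♭ˣ) ∧ (B1): `β := 0`
(`launderingStepPX_of_thinLaunderingPX`, PROVED).  Why it might fail: coherent far-field garbage decays slowly (`j⁻²`) and is removed only modulo affine
retune; the density ratio `nK(win 2R)/nK(win R) ≤ 8·C_δ` must be beaten by `a(R₁)²`.  TRUE-type (heuristic); L; IDEA-NAMED → INSTRUMENTABLE (census ask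
E: the one-step contraction `β(R)` on stepped fcc windows). [this file, g40] -/
def LaunderingStepPX (aHi Λ θ s s' : ℝ) : Prop :=
  ∃ c : ℝ, 0 < c ∧ ∀ δ : ℝ, 0 < δ → ∀ a : ℝ, 0 < a → ∀ C₁ : ℝ, 0 ≤ C₁ →
    ∃ A : ℝ, 0 ≤ A ∧ ∃ β : ℝ, 0 ≤ β ∧ β < 1 ∧ ∃ η₁ : ℝ, 0 < η₁ ∧ ∃ R₁ : ℝ, 0 < R₁ ∧
      ∀ S : Set E3, IsDoorSetP aHi δ S → (∀ q ∈ S, IsTwoShellAffineGood θ S q) → HasQuadExcess C₁ S →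
        ∀ η : ℝ, 0 < η → η ≤ η₁ → ∀ R : ℝ, R₁ ≤ R → η * R ^ 2 < c →
          (∀ D : ℝ, R ≤ D → NearHomH1BDE a s Λ η 4 D S (atomsIn (μS S) 0 D)) →
            ∀ C : ℝ, 0 ≤ C → IsLaunderedAt a s' Λ S η (2 * R) C → IsLaunderedAt a s' Λ S η R (A + β * C)

/-! ### XVIII.3  ★★★ The seam (PROVED): (Λ♭ˣ) ⟸ (B1)(s) ∧ (Λ₀) ∧ (Λ↑) — the regress as a dyadic downward induction -/

/-- ★★★ **(Λ♭ˣ) ⟸ (B1)(s) ∧ (Λ₀) ∧ (Λ↑) (PROVED).**  `c₀ := min(c_a,c_s)/4`; given a thin pair `(η, R)` let `n` be the least natural number with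
`4ⁿ·η·R² ≥ c⋆/4` (`c⋆ := min(c_a,c_s)`; it exists by Archimedes, is `≥ 1`, and by minimality `4ⁿ·η·R² < c⋆`, so all dyadic scales `2ᵏ·R`, `k ≤ n`, are thin
for both pieces); at the top scale `2ⁿ·R` the multi-scale hypothesis supplies the datum, (B1) + D1 the true-word bond-isomorphic chart and (Λ₀) the
level `A₀ + K/(η·4ⁿR²) ≤ A₀ + 4K/c⋆ ≤ Cmax := A/(1−β) + A₀ + 4K/c⋆`; the invariant `A + β·Cmax ≤ Cmax` carries `Cmax` down the `n` steps of (Λ↑);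
`Cl := Cmax + 1`.  The given scale-`R` datum and chart of (Λ♭ˣ) are not needed (the conclusion of (Λ♭ˣ) does not mention them). [this file, g40] -/
theorem thinLaunderingPX_of_apriori_step {aHi Λ θ s s' : ℝ} (h1 : WordTransplantP aHi Λ θ s)
    (h0 : LaunderingAprioriPX aHi Λ θ s s') (hs : LaunderingStepPX aHi Λ θ s s') : ThinLaunderingPX aHi Λ θ s s' := by
  classical
  obtain ⟨ca, hca, H0⟩ := h0
  obtain ⟨cs, hcs, Hs⟩ := hs
  obtain ⟨c, hc_def⟩ : ∃ c : ℝ, c = min ca cs := ⟨_, rfl⟩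
  have hc : 0 < c := by rw [hc_def]; exact lt_min hca hcs
  have hcca : c ≤ ca := by rw [hc_def]; exact min_le_left _ _
  have hccs : c ≤ cs := by rw [hc_def]; exact min_le_right _ _
  refine ⟨c / 4, by positivity, fun δ hδ a ha C₁ hC₁ => ?_⟩
  obtain ⟨ηB, hηB, RB, hRB, H1⟩ := h1 δ hδ a ha
  obtain ⟨A₀, hA₀, K, hK, ηa, hηa, Ra, hRa, H0'⟩ := H0 δ hδ a ha C₁ hC₁
  obtain ⟨A, hA, β, hβ0, hβ1, ηs, hηs, Rs, hRs, Hs'⟩ := Hs δ hδ a ha C₁ hC₁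
  -- the invariant level `Cmax`
  have h1β : 0 < 1 - β := sub_pos.mpr hβ1
  obtain ⟨Cmax, hCmax_def⟩ : ∃ C : ℝ, C = A / (1 - β) + A₀ + 4 * K / c := ⟨_, rfl⟩
  have hCmax0 : 0 ≤ Cmax := by rw [hCmax_def]; positivity
  have hkey : (1 - β) * Cmax = A + (1 - β) * (A₀ + 4 * K / c) := by
    rw [hCmax_def]; field_simp; ring
  have hstep_le : A + β * Cmax ≤ Cmax := by
    have h2 : 0 ≤ (1 - β) * (A₀ + 4 * K / c) := by positivity
    nlinarith [hkey, h2]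
  have htop_le : ∀ x : ℝ, c / 4 ≤ x → A₀ + K / x ≤ Cmax := by
    intro x hx
    have h3 : K / x ≤ 4 * K / c :=
      calc K / x ≤ K / (c / 4) := div_le_div_of_nonneg_left hK (by positivity) hx
        _ = 4 * K / c := by rw [div_div_eq_mul_div]; ring
    have h4 : 0 ≤ A / (1 - β) := by positivity
    rw [hCmax_def]; linarith
  refine ⟨Cmax + 1, by linarith, min (min ηB ηa) ηs, lt_min (lt_min hηB hηa) hηs,
    max (max RB Ra) Rs, lt_max_of_lt_right hRs, ?_⟩
  intro S hS hgood hQ η hη hηle R hR hthin hms L w' Ψ' τ' hE' hreg' w Ψ₀ hEw hbij hiso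
  have hηB' : η ≤ ηB := hηle.trans ((min_le_left _ _).trans (min_le_left _ _))
  have hηa' : η ≤ ηa := hηle.trans ((min_le_left _ _).trans (min_le_right _ _))
  have hηs' : η ≤ ηs := hηle.trans (min_le_right _ _)
  have hRB' : RB ≤ R := ((le_max_left _ _).trans (le_max_left _ _)).trans hR
  have hRa' : Ra ≤ R := ((le_max_right _ _).trans (le_max_left _ _)).trans hR
  have hRs' : Rs ≤ R := (le_max_right _ _).trans hR
  have hR0 : 0 < R := hRs.trans_le hRs'
  -- the regress depth `n`: the least natural number with `c/4 ≤ 4ⁿ·η·R²`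
  obtain ⟨x, hx_def⟩ : ∃ x : ℝ, x = η * R ^ 2 := ⟨_, rfl⟩
  have hx0 : 0 < x := by rw [hx_def]; positivity
  have hxc : x < c / 4 := by rw [hx_def]; exact hthin
  have hex : ∃ n : ℕ, c / 4 ≤ 4 ^ n * x := by
    obtain ⟨n, hn⟩ := pow_unbounded_of_one_lt (c / 4 / x) (by norm_num : (1 : ℝ) < 4)
    exact ⟨n, ((div_lt_iff₀ hx0).mp hn).le⟩
  obtain ⟨n, hn_def⟩ : ∃ n : ℕ, n = Nat.find hex := ⟨_, rfl⟩
  have hn : c / 4 ≤ 4 ^ n * x := by rw [hn_def]; exact Nat.find_spec hex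
  have hn_lt : (4 : ℝ) ^ n * x < c := by
    rcases Nat.eq_zero_or_pos n with h0 | hpos
    · exfalso; rw [h0, pow_zero, one_mul] at hn; linarith
    · obtain ⟨m, hm⟩ : ∃ m : ℕ, n = m + 1 := ⟨n - 1, by omega⟩
      have hmin : ¬ (c / 4 ≤ 4 ^ m * x) := Nat.find_min hex (by rw [← hn_def]; omega)
      rw [not_le] at hmin
      calc (4 : ℝ) ^ n * x = 4 * (4 ^ m * x) := by rw [hm, pow_succ]; ring
        _ < 4 * (c / 4) := by linarith
        _ = c := by ring
  -- the dyadic scales `2ᵏ·R`, `k ≤ n`: above `R`, thin for both pieces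
  have hD_ge : ∀ k : ℕ, R ≤ 2 ^ k * R := fun k => le_mul_of_one_le_left hR0.le (one_le_pow₀ (by norm_num))
  have hD_sq : ∀ k : ℕ, η * (2 ^ k * R) ^ 2 = 4 ^ k * x := by
    intro k
    have h4 : ((2 : ℝ) ^ k) ^ 2 = 4 ^ k := by rw [← pow_mul, mul_comm, pow_mul]; norm_num
    rw [hx_def, mul_pow, h4]; ring
  have hthin_k : ∀ k : ℕ, k ≤ n → η * (2 ^ k * R) ^ 2 < c := by
    intro k hk
    rw [hD_sq]
    exact (mul_le_mul_of_nonneg_right (pow_le_pow_right₀ (by norm_num) hk) hx0.le).trans_lt hn_lt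
  -- TOP (the special scale): datum from the multi-scale hypothesis, true-word chart from (B1) + D1, level from (Λ₀)
  have htop : IsLaunderedAt a s' Λ S η (2 ^ n * R) Cmax := by
    have hRD : R ≤ 2 ^ n * R := hD_ge n
    obtain ⟨Ln, wn', hEn', Ψn', τn', hregn'⟩ := hms (2 ^ n * R) hRD
    obtain ⟨sw, hsw, Φ, hΦ⟩ := exists_barlowChart_of_isDoorSetP hS
    have hmsn : ∀ D : ℝ, 2 ^ n * R ≤ D → NearHomH1BDE a s Λ η 4 D S (atomsIn (μS S) 0 D) :=
      fun D hD => hms D (hRD.trans hD)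
    obtain ⟨wn, ΦH, hEwn, hΦH⟩ := H1 S hS hgood η hη hηB' (2 ^ n * R) (hRB'.trans hRD) hmsn Ln wn' Ψn' τn' hEn' hregn'
      sw Φ hsw hΦ
    obtain ⟨Ψ₀n, hbijn, hison⟩ := exists_bijOn_bondIso_of_barlowCharts hΦ hΦH
    have h := H0' S hS hgood hQ η hη hηa' (2 ^ n * R) (hRa'.trans hRD) ((hthin_k n le_rfl).trans_le hcca) hmsn
      Ln wn' Ψn' τn' hEn' hregn' wn Ψ₀n hEwn hbijn hison
    refine h.mono (htop_le _ ?_) hη.le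
    rw [hD_sq]; exact hn
  -- DOWN (the generic scales): `n` applications of (Λ↑) with the invariant level `Cmax`
  have hdown : ∀ j : ℕ, j ≤ n → IsLaunderedAt a s' Λ S η (2 ^ (n - j) * R) Cmax := by
    intro j
    induction j with
    | zero => intro _; simpa using htop
    | succ j ih =>
      intro hj
      have hprev := ih ((Nat.le_succ j).trans hj)
      have hk : n - j = (n - (j + 1)) + 1 := by omega
      rw [hk, pow_succ, mul_comm ((2 : ℝ) ^ (n - (j + 1))) 2, mul_assoc] at hprev
      have hR' : R ≤ 2 ^ (n - (j + 1)) * R := hD_ge _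
      have h := Hs' S hS hgood hQ η hη hηs' (2 ^ (n - (j + 1)) * R) (hRs'.trans hR')
        ((hthin_k _ (by omega)).trans_le hccs) (fun D hD => hms D (hR'.trans hD)) Cmax hCmax0 hprev
      exact h.mono hstep_le hη.le
  have hbase := hdown n le_rfl
  rw [Nat.sub_self, pow_zero, one_mul] at hbase
  obtain ⟨L₁, w₁, Ψ₁, ρ, τ₁, Φ, hE₁, hreg₁, hbij₁, hiso₁, hlay₁⟩ := hbase.mono (by linarith : Cmax ≤ Cmax + 1) hη.le
  exact ⟨L₁, w₁, Ψ₁, ρ, τ₁, Φ, hE₁, hreg₁, hbij₁, hiso₁, hlay₁⟩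

/-! ### XVIII.4  Nothing lost (PROVED): the target implies each piece -/

/-- **(Λ♭ˣ) ⇒ (Λ₀)** with `A₀ := Cl`, `K := 0` (PROVED): (Λ₀) is a projection of the target. [this file, g40] -/
theorem launderingAprioriPX_of_thinLaunderingPX {aHi Λ θ s s' : ℝ} (h : ThinLaunderingPX aHi Λ θ s s') :
    LaunderingAprioriPX aHi Λ θ s s' := by
  obtain ⟨c₀, hc₀, H⟩ := h
  refine ⟨c₀, hc₀, fun δ hδ a ha C₁ hC₁ => ?_⟩
  obtain ⟨Cl, hCl, η₁, hη₁, R₁, hR₁, H'⟩ := H δ hδ a ha C₁ hC₁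
  refine ⟨Cl, by linarith, 0, le_rfl, η₁, hη₁, R₁, hR₁, ?_⟩
  intro S hS hgood hQ η hη hηle D hD hthin hms L w' Ψ' τ' hE' hreg' w Ψ₀ hEw hbij hiso
  obtain ⟨L₁, w₁, Ψ₁, ρ, τ₁, Φ, hE₁, hreg₁, hbij₁, hiso₁, hlay₁⟩ :=
    H' S hS hgood hQ η hη hηle D hD hthin hms L w' Ψ' τ' hE' hreg' w Ψ₀ hEw hbij hiso
  refine ⟨L₁, w₁, Ψ₁, ρ, τ₁, Φ, hE₁, ?_, hbij₁, hiso₁, hlay₁⟩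
  rwa [zero_div, add_zero]

/-- **(Λ♭ˣ) ∧ (B1)(s) ⇒ (Λ↑)** with `A := Cl`, `β := 0` (PROVED): in the thin regime the target launders the scale-`R` datum of the multi-scale
hypothesis directly ((B1) + D1 supply its true-word bond-isomorphic chart), ignoring the laundered `2R`-object. [this file, g40] -/
theorem launderingStepPX_of_thinLaunderingPX {aHi Λ θ s s' : ℝ} (h1 : WordTransplantP aHi Λ θ s)
    (h : ThinLaunderingPX aHi Λ θ s s') : LaunderingStepPX aHi Λ θ s s' := by
  obtain ⟨c₀, hc₀, H⟩ := h
  refine ⟨c₀, hc₀, fun δ hδ a ha C₁ hC₁ => ?_⟩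
  obtain ⟨ηB, hηB, RB, hRB, H1⟩ := h1 δ hδ a ha
  obtain ⟨Cl, hCl, η₁, hη₁, R₁, hR₁, H'⟩ := H δ hδ a ha C₁ hC₁
  refine ⟨Cl, by linarith, 0, le_rfl, zero_lt_one, min ηB η₁, lt_min hηB hη₁, max RB R₁, lt_max_of_lt_right hR₁, ?_⟩
  intro S hS hgood hQ η hη hηle R hR hthin hms C _hC _h2R
  obtain ⟨L, w', hE', Ψ', τ', hreg'⟩ := hms R le_rfl
  obtain ⟨sw, hsw, Φ, hΦ⟩ := exists_barlowChart_of_isDoorSetP hS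
  obtain ⟨w, ΦH, hEw, hΦH⟩ := H1 S hS hgood η hη (hηle.trans (min_le_left _ _)) R ((le_max_left _ _).trans hR) hms
    L w' Ψ' τ' hE' hreg' sw Φ hsw hΦ
  obtain ⟨Ψ₀, hbij, hiso⟩ := exists_bijOn_bondIso_of_barlowCharts hΦ hΦH
  obtain ⟨L₁, w₁, Ψ₁, ρ, τ₁, Φ₁, hE₁, hreg₁, hbij₁, hiso₁, hlay₁⟩ :=
    H' S hS hgood hQ η hη (hηle.trans (min_le_right _ _)) R ((le_max_right _ _).trans hR) hthin hms L w' Ψ' τ' hE' hreg'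
      w Ψ₀ hEw hbij hiso
  refine ⟨L₁, w₁, Ψ₁, ρ, τ₁, Φ₁, hE₁, ?_, hbij₁, hiso₁, hlay₁⟩
  rwa [zero_mul, add_zero]

/-! ### XVIII.5  The sub-line and the columns `_16XH18_tol` (ν generic), `_16XH18` (ν := 1/2000) -/

/-- ★★ **(A0ˣ)(s,s′) ⟸ (B1)(s) ∧ (G♯ˣ) ∧ (Λ₀) ∧ (Λ↑) ∧ (Υ)(s′) ∧ (A0♯⁺)(s′) at `aHi = 1`, `s ≤ s′` (PROVED)** — part TN's sub-line with (Λ♭ˣ) cut. [this file, g40] -/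
theorem globalChartRegistrationPX_of_subline_scales {Λ θ s s' : ℝ} (hss : s ≤ s') (h1 : WordTransplantP 1 Λ θ s)
    (hT : GradReframingThickP 1 Λ θ s s') (h0 : LaunderingAprioriPX 1 Λ θ s s') (hu' : LaunderingStepPX 1 Λ θ s s')
    (hu : LateralUntwistP 1 Λ θ s') (hL : BondIsoLevelsP 1 Λ θ s') : GlobalChartRegistrationPX 1 Λ θ s s' :=
  globalChartRegistrationPX_of_subline hss h1 hT (thinLaunderingPX_of_apriori_step h1 h0 hu') hu hL

/-- ★★★ **COLUMN `_16XH18_tol` — TWENTY-THREE opaque leaves at a generic energy tolerance `ν`**: `_16XH17_tol` with the leaf (Λ♭ˣ) `ThinLaunderingPX`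
replaced by (Λ₀) `LaunderingAprioriPX` ∧ (Λ↑) `LaunderingStepPX` (seam `thinLaunderingPX_of_apriori_step`, (B1) used twice): `LatticeLiouvilleCert →
LayeredLiouvilleCert → R_G → X → Z_E(1/100) → P(1/100) → T → U♮ᴱ(ν) → B1(1/100) → G♯ˣ → Λ₀ → Λ↑ → Υc → Υb → A0♯⁺ → N♮(ν) → FF → E → A⁰ᴱ(ν) → D⁰ᴱ(ν) →
C♭ᴱ(ν) → R_W → PeriodicBulkGapDoor 2 → VisibleGap (1/50) ∧ PertRegime (1/50)`. [this file, g40] -/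
theorem gap_and_pert_1_50_of_certs_16XH18_tol {ν : ℝ} (hL : LatticeLiouvilleCert) (hL' : LayeredLiouvilleCert)
    (hR : OscRigidityL2BDPG 1 2 (1 / 16) (1 / 16)) (hX : ExcessFlatnessControlP 1 2 (1 / 16) (1 / 16))
    (hE : ExcessChartLocalisationP 1 2 (1 / 16) (1 / 100)) (hP : RegistrationP 1 2 (1 / 16) (1 / 100))
    (hT : TailDominationCert) (hU : UniformTameStabilityE (1 / 50) 2 ν)
    (h1 : WordTransplantP 1 2 (1 / 16) (1 / 100)) (hGT : GradReframingThickP 1 2 (1 / 16) (1 / 100) (1 / 50))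
    (hΛ0 : LaunderingAprioriPX 1 2 (1 / 16) (1 / 100) (1 / 50)) (hΛs : LaunderingStepPX 1 2 (1 / 16) (1 / 100) (1 / 50))
    (hUc : UntwistCollarP 1 2 (1 / 16) (1 / 50)) (hUb : UntwistBookkeepingP 1 2 (1 / 50))
    (hl : BondIsoLevelsP 1 2 (1 / 16) (1 / 50)) (hN : EnergyNearChartPX 1 2 (1 / 16) (1 / 50) ν)
    (hF : TailForceSlavingP 1 2 (1 / 16) (1 / 50))
    (hE' : LipDualLinearisationP 1 2 (1 / 16) (1 / 50)) (hA : L2HarmonicApproxPE 1 2 (1 / 16) (1 / 50) ν)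
    (hD : PositionDecayPLE 1 2 (1 / 16) (1 / 50) ν) (hC : PositionCaccioppoliPGE 1 2 (1 / 16) (1 / 50) ν)
    (hW : WildFractionPG 1 2 (1 / 16) (1 / 50)) (hG : PeriodicBulkGapDoor 2) : VisibleGap (1 / 50) ∧ PertRegime (1 / 50) :=
  gap_and_pert_1_50_of_certs_16XH17_tol hL hL' hR hX hE hP hT hU h1 hGT (thinLaunderingPX_of_apriori_step h1 hΛ0 hΛs)
    hUc hUb hl hN hF hE' hA hD hC hW hG

/-- ★★★ **COLUMN `_16XH18` — the column of record's candidate with (Λ♭ˣ) cut (ν := 1/2000; 23 leaves, no refuted leaf)**.  Open leaves on the (A0)-line: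
(B1)(1/100) [XL], (G♯ˣ) [L], (Λ₀) [M–L], (Λ↑) [L], (Υc) [M], (Υb) [S], (A0♯⁺) [L]; the rest as in `_16XH17`. [this file, g40] -/
theorem gap_and_pert_1_50_of_certs_16XH18 (hL : LatticeLiouvilleCert) (hL' : LayeredLiouvilleCert)
    (hR : OscRigidityL2BDPG 1 2 (1 / 16) (1 / 16)) (hX : ExcessFlatnessControlP 1 2 (1 / 16) (1 / 16))
    (hE : ExcessChartLocalisationP 1 2 (1 / 16) (1 / 100)) (hP : RegistrationP 1 2 (1 / 16) (1 / 100))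
    (hT : TailDominationCert) (hU : UniformTameStabilityE (1 / 50) 2 (1 / 2000))
    (h1 : WordTransplantP 1 2 (1 / 16) (1 / 100)) (hGT : GradReframingThickP 1 2 (1 / 16) (1 / 100) (1 / 50))
    (hΛ0 : LaunderingAprioriPX 1 2 (1 / 16) (1 / 100) (1 / 50)) (hΛs : LaunderingStepPX 1 2 (1 / 16) (1 / 100) (1 / 50))
    (hUc : UntwistCollarP 1 2 (1 / 16) (1 / 50)) (hUb : UntwistBookkeepingP 1 2 (1 / 50))
    (hl : BondIsoLevelsP 1 2 (1 / 16) (1 / 50)) (hN : EnergyNearChartPX 1 2 (1 / 16) (1 / 50) (1 / 2000))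
    (hF : TailForceSlavingP 1 2 (1 / 16) (1 / 50))
    (hE' : LipDualLinearisationP 1 2 (1 / 16) (1 / 50)) (hA : L2HarmonicApproxPE 1 2 (1 / 16) (1 / 50) (1 / 2000))
    (hD : PositionDecayPLE 1 2 (1 / 16) (1 / 50) (1 / 2000)) (hC : PositionCaccioppoliPGE 1 2 (1 / 16) (1 / 50) (1 / 2000))
    (hW : WildFractionPG 1 2 (1 / 16) (1 / 50)) (hG : PeriodicBulkGapDoor 2) : VisibleGap (1 / 50) ∧ PertRegime (1 / 50) :=
  gap_and_pert_1_50_of_certs_16XH18_tol hL hL' hR hX hE hP hT hU h1 hGT hΛ0 hΛs hUc hUb hl hN hF hE' hA hD hC hW hG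

end Summit.AtomisticToContinuum.Crystallization.Theorems.ChartedZeroExcessLayeredLatticeLiouville

end
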